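import Summits.KontsevichZagierPeriods.KontsevichZagierPeriods.Theorems.SoloInformedParamCombo
import HarnessLib

/-!
# Generator keys, the class-function principle, and on-domain coincidence

Three free-abelian-group facts behind the kernel THEOREM R / THEOREM T for bounded `KZ_ℝ` chains.

* `P.key p t = ⟨dim t, (P.term t).rep p⟩` is the generator of `KZOver.FormalRep ℝ` contributed by
  the term `t` at the parameter `p`; `FreeAbelianGroup.lift w (P.combo p) = ∑ coef_t • w (key p t)`
  (`lift_combo`) and `eval (P.combo p) = ∑ coef_t • value` (`eval_combo`).
* **Class-function principle** (`sum_eq_of_combo_eq_sub`): if `P.combo p₀ = [A] − [B]` with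
  `[A] ≠ [B]` and new values `u t` are constant on the classes `{key p₀ t = key p₀ t'}` and equal
  to `a`, `b` on the classes of `A`, `B`, then `∑ coef_t • u t = a − b` — proved by evaluating the
  additive map `lift w` for a class function `w` on `P.combo p₀` in two ways. This is how a
  combination shaped like `[A] − [B]` at ONE parameter controls the values at ALL good parameters.
* **On-domain coincidence** (`soloInformed_sub_mem_relationsBdd_of_eqOn`): bounded
  representations with the same domain and integrands equal on it differ by a bounded relation
  (two integrand-additivity moves through the zero integrand).

References: [cite: KontsevichZagier2001, §1.2]; [cite: BochnakCosteRoy1998, §2.2].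
-/

noncomputable section

open Set MeasureTheory MvPolynomial Literature.ModelTheory.ExponentialFields
  Literature.NumberTheory.Transcendental

namespace Summit.KontsevichZagierPeriods.KontsevichZagierPeriods.Theorems

namespace SoloInformedPCombo

variable {K : Type} (P : SoloInformedPCombo K) (p : K → ℝ)

/-- The generator contributed by the term `t` at the parameter `p`.
[cite: KontsevichZagier2001, §1.2] -/
def key (t : P.ι) : Σ n, KZOver.IntegralRep ℝ n := ⟨P.dim t, (P.term t).rep p⟩

/-- The denoted element as a combination of generator keys. [cite: KontsevichZagier2001, §1.2] -/
theorem combo_eq_sum_key : P.combo p = ∑ t, P.coef t • FreeAbelianGroup.of (P.key p t) := rfl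

/-- **Additive maps on the denoted element.** [cite: KontsevichZagier2001, §1.2] -/
theorem lift_combo {β : Type*} [AddCommGroup β] (w : (Σ n, KZOver.IntegralRep ℝ n) → β) :
    FreeAbelianGroup.lift w (P.combo p) = ∑ t, P.coef t • w (P.key p t) := by
  rw [combo_eq_sum_key, map_sum]
  simp only [map_zsmul, FreeAbelianGroup.lift_apply_of]

/-- **Evaluation of the denoted element.** [cite: KontsevichZagier2001, §1.2] -/
theorem eval_combo : KZOver.eval ℝ (P.combo p) = ∑ t, P.coef t • ((P.term t).rep p).value := by
  unfold combo
  rw [map_sum]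
  simp only [map_zsmul, KZOver.eval_of]

/-- At a good parameter (the combination is a bounded relation) the weighted values sum to zero.
[cite: KontsevichZagier2001, §1.2] -/
theorem sum_value_eq_zero (h : P.combo p ∈ soloInformedRelationsBdd ℝ) :
    ∑ t, P.coef t • ((P.term t).rep p).value = 0 := by
  rw [← eval_combo]
  exact soloInformed_eval_eq_zero_of_mem_relationsBdd h

/-- **Class-function principle.** If `P.combo p₀ = [A] − [B]` with distinct generators and the new
values `u` are constant on key-classes and equal to `a`, `b` on the classes of `A`, `B`, then
`∑ coef_t • u t = a − b`. [cite: KontsevichZagier2001, §1.2] -/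
theorem sum_eq_of_combo_eq_sub {β : Type*} [AddCommGroup β] {n m : ℕ}
    {A : KZOver.IntegralRep ℝ n} {B : KZOver.IntegralRep ℝ m} {p₀ : K → ℝ}
    (hc : P.combo p₀ = KZOver.of A - KZOver.of B)
    (hAB : (⟨n, A⟩ : Σ k, KZOver.IntegralRep ℝ k) ≠ ⟨m, B⟩) (u : P.ι → β) (a b : β)
    (hu : ∀ t t', P.key p₀ t = P.key p₀ t' → u t = u t')
    (ha : ∀ t, P.key p₀ t = ⟨n, A⟩ → u t = a) (hb : ∀ t, P.key p₀ t = ⟨m, B⟩ → u t = b) :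
    ∑ t, P.coef t • u t = a - b := by
  classical
  let w : (Σ k, KZOver.IntegralRep ℝ k) → β := fun x =>
    if x = ⟨n, A⟩ then a else if x = ⟨m, B⟩ then b else
      if h : ∃ t, P.key p₀ t = x then u h.choose else 0
  have hw : ∀ t, w (P.key p₀ t) = u t := by
    intro t
    simp only [w]
    split_ifs with h₁ h₂ h₃
    · exact (ha t h₁).symm
    · exact (hb t h₂).symm
    · exact hu _ _ h₃.choose_spec
    · exact absurd ⟨t, rfl⟩ h₃
  have hwA : w ⟨n, A⟩ = a := by simp only [w, if_pos rfl]
  have hwB : w ⟨m, B⟩ = b := by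
    have hne : (⟨m, B⟩ : Σ k, KZOver.IntegralRep ℝ k) ≠ ⟨n, A⟩ := fun h => hAB h.symm
    simp only [w, hne, if_false, if_true]
  have h1 : FreeAbelianGroup.lift w (P.combo p₀) = ∑ t, P.coef t • u t := by
    rw [lift_combo]
    simp only [hw]
  have h2 : FreeAbelianGroup.lift w (P.combo p₀) = a - b := by
    rw [hc]
    show FreeAbelianGroup.lift w (FreeAbelianGroup.of ⟨n, A⟩ - FreeAbelianGroup.of ⟨m, B⟩) = a - b
    rw [map_sub, FreeAbelianGroup.lift_apply_of, FreeAbelianGroup.lift_apply_of, hwA, hwB]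
  exact h1.symm.trans h2

end SoloInformedPCombo

/-! ### On-domain coincidence is a bounded relation -/

section EqOn

variable {k : Type*} [CommRing k] [Algebra k ℝ] {n : ℕ}

/-- The zero representation on a `k`-semialgebraic domain. [cite: KontsevichZagier2001, §1.1] -/
def soloInformedZeroRep (x : KZOver.IntegralRep k n) : KZOver.IntegralRep k n where
  domain := x.domain
  integrand := fun _ => 0
  isSemialgebraic_domain := x.isSemialgebraic_domain
  isSemialgebraicFunOn_integrand :=
    (isSemialgebraicFunOn_aeval x.isSemialgebraic_domain (0 : MvPolynomial (Fin n) k)).congr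
      fun y _ => by simp
  integrableOn := integrableOn_zero

/-- The zero representation is bounded when its domain is. [cite: KontsevichZagier2001, §1.1] -/
theorem soloInformedBddRep_zeroRep {x : KZOver.IntegralRep k n} (hx : SoloInformedBddRep x) :
    SoloInformedBddRep (soloInformedZeroRep x) := by
  obtain ⟨M, hM₁, hM₂⟩ := hx
  refine ⟨M, hM₁, fun y hy => ?_⟩
  have h0 : (0 : ℝ) ≤ M := (abs_nonneg _).trans (hM₂ y hy)
  simpa [soloInformedZeroRep] using h0

/-- The zero representation is a bounded relation (one integrand-additivity move `0 = 0 + 0`).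
[cite: KontsevichZagier2001, §1.2 rule (1)] -/
theorem soloInformed_of_zeroRep_mem_relationsBdd {x : KZOver.IntegralRep k n}
    (hx : SoloInformedBddRep x) :
    KZOver.of (soloInformedZeroRep x) ∈ soloInformedRelationsBdd k := by
  have hz := soloInformedBddRep_zeroRep hx
  have hmove : KZOver.of (soloInformedZeroRep x) - KZOver.of (soloInformedZeroRep x) -
      KZOver.of (soloInformedZeroRep x) ∈ soloInformedRelationsBdd k := by
    refine soloInformed_mem_relationsBdd_of_mem_generators (Or.inl (Or.inl (Or.inr ?_)))
    refine ⟨n, _, _, _, hz, hz, hz, rfl, rfl, fun y _ => ?_, rfl⟩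
    simp [soloInformedZeroRep]
  rw [sub_self, zero_sub] at hmove
  exact neg_mem_iff.1 hmove

/-- A representation agreeing on the (common) domain with a bounded one is bounded.
[cite: KontsevichZagier2001, §1.1] -/
theorem soloInformedBddRep_of_eqOn {x y : KZOver.IntegralRep k n} (hx : SoloInformedBddRep x)
    (hd : x.domain = y.domain) (hi : EqOn x.integrand y.integrand x.domain) :
    SoloInformedBddRep y := by
  obtain ⟨M, hM₁, hM₂⟩ := hx
  refine ⟨M, fun z hz => hM₁ z (hd ▸ hz), fun z hz => ?_⟩
  rw [← hd] at hz
  rw [← hi hz]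
  exact hM₂ z hz

/-- **On-domain coincidence.** Bounded representations with the same domain and integrands equal
on it differ by a bounded relation (two integrand-additivity moves).
[cite: KontsevichZagier2001, §1.2 rule (1)] -/
theorem soloInformed_sub_mem_relationsBdd_of_eqOn {x y : KZOver.IntegralRep k n}
    (hx : SoloInformedBddRep x) (hd : x.domain = y.domain)
    (hi : EqOn x.integrand y.integrand x.domain) :
    KZOver.of x - KZOver.of y ∈ soloInformedRelationsBdd k := by
  have hy := soloInformedBddRep_of_eqOn hx hd hi
  have hz := soloInformedBddRep_zeroRep hx
  have hmove : KZOver.of x - KZOver.of y - KZOver.of (soloInformedZeroRep x) ∈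
      soloInformedRelationsBdd k := by
    refine soloInformed_mem_relationsBdd_of_mem_generators (Or.inl (Or.inl (Or.inr ?_)))
    refine ⟨n, x, y, soloInformedZeroRep x, hx, hy, hz, hd.symm, rfl, fun z hz' => ?_, rfl⟩
    simp only [Pi.add_apply, soloInformedZeroRep, add_zero]
    exact hi hz'
  have h := add_mem hmove (soloInformed_of_zeroRep_mem_relationsBdd hx)
  rwa [sub_add_cancel] at h

/-- **On-domain coincident bounded representations are boundedly equivalent** (hence equivalent
and of equal value). [cite: KontsevichZagier2001, §1.2] -/
theorem soloInformedBddEquivalent_of_eqOn {x y : KZOver.IntegralRep k n} (hx : SoloInformedBddRep x)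
    (hd : x.domain = y.domain) (hi : EqOn x.integrand y.integrand x.domain) :
    SoloInformedBddEquivalent x y :=
  soloInformed_sub_mem_relationsBdd_of_eqOn hx hd hi

end EqOn

end Summit.KontsevichZagierPeriods.KontsevichZagierPeriods.Theorems
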